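import Summits.FinalStateConjecture.FinalStateConjecture.Theses.PhotonSphereChannels
import Summits.FinalStateConjecture.FinalStateConjecture.Theses.SwallowTheDatum
import Literature.Geometry.Lorentzian.Hypersurface
import Literature.Geometry.Lorentzian.CausalityProofs
import Literature.Geometry.Lorentzian.CausalityPushUp

/-!
# `TameCensorship` (crux `stmt-FinalStateConjecture-10047`), line `crush-the-swallowed-interior`:
# the vendored `futureCauchyDevelopment` of a closed set is the set itself, so the line's
# `IsCrushable` and `NullTerminality` collapse (negative-side support, drefute seat)

`LorentzianMetric.futureCauchyDevelopment` (`Literature/Geometry/Lorentzian/Causality.lean`) quantifies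
over past-inextendible causal curves in the VENDORED sense
`IsPastInextendible γ s := s.Nonempty ∧ (¬ BddBelow s ∨ ¬ ∃ p, Tendsto γ (𝓝[>] sInf s) (𝓝 p))`, which the
same file (section "Endpoints, endless curves and Cauchy hypersurfaces (faithful notions)") records as
mis-formalised: a curve on a parameter set unbounded below is "past inextendible" whatever its endpoints
(compare `LorentzianMetric.IsCauchySurface.isEmpty`, `CausalityProofs.lean`). Proved here, `sorry`-free and
without new definitions:

* `futureCauchyDevelopment_eq_self_of_isClosed` — on a manifold without boundary `D⁺(S) = S` for every
  CLOSED `S` (dual `pastCauchyDevelopment_eq_self_of_isClosed`, `cauchyDevelopment_eq_self_of_isClosed`);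
* `eq_empty_of_isClosed_of_isAchronal_of_causalFuture_subset` — a closed achronal `S` with
  `J⁺(S) ⊆ D⁺(S)` is empty;
* `isEmpty_of_crush_clauses` — hence the crush hypersurface `S″ = range f` of any witness of the line's
  `IsCrushable 𝒟 K` (skeleton `Cruxes/TameCensorship/Lines/crush-the-swallowed-interior.lean`: closed,
  achronal, `J⁺(S″) ⊆ D⁺(S″)`, `J⁺(ι '' K) ⊆ C ∪ I⁺(S″)`) is EMPTY, and `IsCrushable 𝒟 K` is exactly
  relative compactness of the swallowed region `J⁺(ι '' K)` (`crush_clauses_iff_exists_isCompact_superset`,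
  both directions; the empty `3`-manifold `⊥ ⊆ E3` is the witness of the converse). For a nonempty core
  `K` of a Cauchy development this is false (non-imprisonment), so `stub_crush` is void and the composition
  `TameCensorship_of` always runs through `stub_residue`;
* `eventually_mem_futureCauchyDevelopment_range_iff` — the hypothesis of the line's `NullTerminality`
  ("`γ` eventually in `D⁺(range f)`", `range f` closed) is literally "`γ` eventually IN `range f`".

Repair recorded for the planner: use the faithful domain of dependence built on `IsPastEndless`.
-/

set_option linter.dupNamespace false

noncomputable section

open Set Filter Function Bundle
open scoped Manifold ContDiff Topology

namespace Summit.FinalStateConjecture.FinalStateConjecture.Theorems.TameCensorship.Negative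

open Literature.Geometry.Lorentzian
open Literature.Geometry.Lorentzian.LorentzianMetric

/-! ## §1 The vendored `D⁺` of a closed set is the set itself -/

section General

variable {E : Type*} [NormedAddCommGroup E] [NormedSpace ℝ E] {H : Type*} [TopologicalSpace H]
  {I : ModelWithCorners ℝ E H} {n : ℕ∞ω} {M : Type*} [TopologicalSpace M] [ChartedSpace H M]
  [IsManifold I ∞ M]

/-- **Junk theorem.** On a manifold without boundary, the vendored future Cauchy development of a
CLOSED set `S` is `S` itself: `D⁺(S) = S`. If `p ∈ D⁺(S) ∖ S`, the local cone lemma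
(`exists_nhds_forall_isFutureTimelikeCurveOn_from`) gives a future timelike segment `γ : [0, 1] → M`
ending at `γ 1 = p`; by continuity its tail lies in the open set `Sᶜ`; reparametrised by
`ψ u = 1 - δ' (1 - exp u)` over `(-∞, 0]` it is a future causal curve on `Iic 0`, "past-inextendible"
because `Iic 0` is unbounded below, through `p` at `u = 0`, and it misses `S` — contradiction.
Compare Hawking–Ellis 1973, §6.2, p. 184 and §6.5 (the printed `D⁺`). -/
theorem futureCauchyDevelopment_eq_self_of_isClosed [BoundarylessManifold I M]
    (g : LorentzianMetric I n M) (τ : TimeOrientation g) {S : Set M} (hS : IsClosed S) :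
    g.futureCauchyDevelopment τ S = S := by
  refine Set.Subset.antisymm (fun p hp ↦ ?_) (subset_futureCauchyDevelopment S)
  by_contra hpS
  obtain ⟨q', U, hU, hcurve⟩ := g.exists_nhds_forall_isFutureTimelikeCurveOn_from τ
    (BoundarylessManifold.isInteriorPoint (I := I) (x := p))
  obtain ⟨γ, hγ, -, hγ1⟩ := hcurve p (mem_of_mem_nhds hU)
  have hcont : ContinuousAt γ 1 := (hγ 1 ⟨zero_le_one, le_rfl⟩).1.continuousAt
  have hSc : Sᶜ ∈ 𝓝 (γ 1) := by
    rw [hγ1]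
    exact hS.isOpen_compl.mem_nhds hpS
  obtain ⟨δ, hδ, hδS⟩ : ∃ δ > 0, ∀ t : ℝ, dist t 1 < δ → γ t ∈ Sᶜ := by
    obtain ⟨δ, hδ, h⟩ := Metric.mem_nhds_iff.mp (hcont.preimage_mem_nhds hSc)
    exact ⟨δ, hδ, fun t ht ↦ h ht⟩
  set δ' : ℝ := min δ 1 / 2 with hδ'
  have hδ'pos : 0 < δ' := by
    have : 0 < min δ 1 := lt_min hδ one_pos
    positivity
  have hδ'lt : δ' < δ := by
    have h1 : min δ 1 ≤ δ := min_le_left _ _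
    rw [hδ']
    linarith
  have hδ'le : δ' ≤ 1 / 2 := by
    have h1 : min δ 1 ≤ 1 := min_le_right _ _
    rw [hδ']
    linarith
  set ψ : ℝ → ℝ := fun u ↦ 1 - δ' * (1 - Real.exp u) with hψ
  have hψ' : ∀ u, HasDerivAt ψ (δ' * Real.exp u) u := fun u ↦ by
    have h := ((Real.hasDerivAt_exp u).const_sub 1).const_mul δ'
    have h2 : HasDerivAt ψ (-(δ' * -Real.exp u)) u := h.const_sub 1
    exact h2.congr_deriv (by ring)
  have hψpos : ∀ u, 0 < δ' * Real.exp u := fun u ↦ mul_pos hδ'pos (Real.exp_pos u)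
  have hψmem : ∀ u : ℝ, u ≤ 0 → ψ u ∈ Icc (0 : ℝ) 1 ∧ dist (ψ u) 1 < δ := by
    intro u hu
    have he0 : 0 < Real.exp u := Real.exp_pos u
    have he1 : Real.exp u ≤ 1 := by simpa using Real.exp_le_exp.mpr hu
    have h1 : 0 ≤ δ' * (1 - Real.exp u) := mul_nonneg hδ'pos.le (by linarith)
    have h2 : δ' * (1 - Real.exp u) < δ' := by nlinarith
    refine ⟨⟨?_, ?_⟩, ?_⟩
    · simp only [hψ]; linarith
    · simp only [hψ]; linarith
    · rw [Real.dist_eq]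
      simp only [hψ]
      rw [show 1 - δ' * (1 - Real.exp u) - 1 = -(δ' * (1 - Real.exp u)) by ring, abs_neg,
        abs_of_nonneg h1]
      linarith
  have hγψ : g.IsFutureTimelikeCurveOn τ (γ ∘ ψ) (Iic 0) :=
    (hγ.comp_of_hasDerivAt hψ' hψpos).mono fun u hu ↦ (hψmem u hu).1
  have hψ0 : (γ ∘ ψ) 0 = p := by simp [hψ, hγ1]
  obtain ⟨t, ht, -, htS⟩ := hp (γ ∘ ψ) (Iic 0) ordConnected_Iic hγψ.isFutureCausalCurveOn
    ⟨⟨0, Set.self_mem_Iic⟩, Or.inl (not_bddBelow_Iic 0)⟩ 0 Set.self_mem_Iic hψ0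
  exact hδS _ (hψmem t ht).2 htS

/-- Time dual: the vendored past Cauchy development of a closed set is the set itself
(Hawking–Ellis 1973, §6.5, time duality). -/
theorem pastCauchyDevelopment_eq_self_of_isClosed [BoundarylessManifold I M]
    (g : LorentzianMetric I n M) (τ : TimeOrientation g) {S : Set M} (hS : IsClosed S) :
    g.pastCauchyDevelopment τ S = S :=
  futureCauchyDevelopment_eq_self_of_isClosed g τ.reverse hS

/-- Hence the vendored two-sided Cauchy development of a closed set is the set itself
(Hawking–Ellis 1973, §6.5). -/
theorem cauchyDevelopment_eq_self_of_isClosed [BoundarylessManifold I M]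
    (g : LorentzianMetric I n M) (τ : TimeOrientation g) {S : Set M} (hS : IsClosed S) :
    g.cauchyDevelopment τ S = S := by
  rw [LorentzianMetric.cauchyDevelopment, futureCauchyDevelopment_eq_self_of_isClosed g τ hS,
    pastCauchyDevelopment_eq_self_of_isClosed g τ hS, Set.union_self]

/-- **A closed achronal set whose causal future lies in its vendored `D⁺` is EMPTY**: every `p ∈ S`
has a point `q⁺ ∈ I⁺(p)` (local cone lemma, time dual: `exists_nhds_subset_chronologicalPast`), and
`q⁺ ∈ I⁺(S) ⊆ J⁺(S) ⊆ D⁺(S) = S` contradicts achronality (O'Neill 1983, Ch. 14, p. 413). -/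
theorem eq_empty_of_isClosed_of_isAchronal_of_causalFuture_subset [BoundarylessManifold I M]
    (g : LorentzianMetric I n M) (τ : TimeOrientation g) {S : Set M} (hS : IsClosed S)
    (hach : g.IsAchronal τ S)
    (hdep : g.causalFuture τ S ⊆ g.futureCauchyDevelopment τ S) : S = ∅ := by
  rw [futureCauchyDevelopment_eq_self_of_isClosed g τ hS] at hdep
  refine Set.eq_empty_of_forall_notMem fun p hp ↦ ?_
  obtain ⟨q', U, hU, hUq⟩ := g.exists_nhds_subset_chronologicalPast τ
    (BoundarylessManifold.isInteriorPoint (I := I) (x := p))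
  have hq' : q' ∈ g.chronologicalFuture τ {p} :=
    mem_chronologicalFuture_of_mem_chronologicalPast (hUq (mem_of_mem_nhds hU))
  have hq'S : q' ∈ S :=
    hdep (g.chronologicalFuture_subset_causalFuture τ S
      (chronologicalFuture_mono (Set.singleton_subset_iff.mpr hp) hq'))
  exact hach p hp q' hq'S hq'

end General

/-! ## §2 Consequences for the line's `IsCrushable` and `NullTerminality` -/

section Crush

variable {X : Type} [TopologicalSpace X] [ChartedSpace E3 X] [IsManifold (𝓡 3) ∞ X]
  [ConnectedSpace X]

/-- **The crush hypersurface of any `IsCrushable` witness is empty**: its image is closed, achronal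
and satisfies `J⁺ ⊆ D⁺` (vendored), hence is `∅` (§1). These are three of the clauses of the line's
`IsCrushable 𝒟 K` (skeleton `Lines/crush-the-swallowed-interior.lean`). -/
theorem isEmpty_of_crush_clauses {D : InitialDataSet (𝓡 3) X} (𝒟 : VacuumCauchyDevelopment D)
    {N : Type} (f : N → 𝒟.carrier) (hclosed : IsClosed (Set.range f))
    (hach : 𝒟.metric.IsAchronal 𝒟.timeOrientation (Set.range f))
    (hdep : 𝒟.metric.causalFuture 𝒟.timeOrientation (Set.range f) ⊆
      𝒟.metric.futureCauchyDevelopment 𝒟.timeOrientation (Set.range f)) : IsEmpty N := by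
  have h := eq_empty_of_isClosed_of_isAchronal_of_causalFuture_subset
    𝒟.metric 𝒟.timeOrientation hclosed hach hdep
  rw [Set.range_eq_empty_iff] at h
  exact h

/-- **The line's `IsCrushable 𝒟 K`, unfolded verbatim, is relative compactness of the swallowed region
`J⁺(ι '' K)`** — and nothing about a contracting hypersurface: (→) the witness hypersurface is empty
(`isEmpty_of_crush_clauses`), so `I⁺(range f) = ∅` and the covering clause reads `J⁺(ι '' K) ⊆ C`;
(←) the empty `3`-manifold `⊥ ⊆ E3` (with `ε = 1`) satisfies every hypersurface clause vacuously,
`range f = ∅` is closed and achronal and `J⁺(∅) = ∅`. -/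
theorem crush_clauses_iff_exists_isCompact_superset {D : InitialDataSet (𝓡 3) X}
    (𝒟 : VacuumCauchyDevelopment D) [𝒟.metric.HasLeviCivita] (K : Set X) :
    (∃ (N : Type) (_ : TopologicalSpace N) (_ : ChartedSpace E3 N) (_ : IsManifold (𝓡 3) ∞ N)
      (f : N → 𝒟.carrier)
      (hpb : PseudoRiemannianMetric.contMDiff_pullbackBilin (𝓡 4) 𝒟.carrier (𝓡 3) N ∞)
      (hf : 𝒟.metric.IsSpacelikeImmersion (𝓡 3) f) (ν : NormalField (𝓡 4) f) (ε : ℝ),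
      0 < ε ∧
      ContMDiff (𝓡 3) (𝓡 4).tangent ∞
        (fun y ↦ (TotalSpace.mk' E4 (f y) (ν y) : TangentBundle (𝓡 4) 𝒟.carrier)) ∧
      𝒟.metric.IsFutureUnitNormal (𝓡 3) 𝒟.timeOrientation f ν ∧
      (∀ y, 𝒟.metric.meanCurvature f hpb hf ν y ≤ -ε) ∧
      IsClosed (Set.range f) ∧ 𝒟.metric.IsAchronal 𝒟.timeOrientation (Set.range f) ∧
      𝒟.metric.causalFuture 𝒟.timeOrientation (Set.range f) ⊆
        𝒟.metric.futureCauchyDevelopment 𝒟.timeOrientation (Set.range f) ∧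
      ∃ C : Set 𝒟.carrier, IsCompact C ∧
        𝒟.metric.causalFuture 𝒟.timeOrientation (𝒟.embed '' K) ⊆
          C ∪ 𝒟.metric.chronologicalFuture 𝒟.timeOrientation (Set.range f)) ↔
    ∃ C : Set 𝒟.carrier, IsCompact C ∧
      𝒟.metric.causalFuture 𝒟.timeOrientation (𝒟.embed '' K) ⊆ C := by
  constructor
  · rintro ⟨N, _, _, _, f, hpb, hf, ν, ε, hε, hν, hunit, hH, hclosed, hach, hdep, C, hC, hsub⟩
    haveI : IsEmpty N := isEmpty_of_crush_clauses 𝒟 f hclosed hach hdep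
    refine ⟨C, hC, fun m hm ↦ ?_⟩
    rcases hsub hm with hmC | hmI
    · exact hmC
    · exfalso
      obtain ⟨p, hp, -⟩ := hmI
      rw [Set.range_eq_empty f] at hp
      exact hp
  · rintro ⟨C, hC, hsub⟩
    haveI : IsEmpty (⊥ : TopologicalSpace.Opens E3) :=
      ⟨fun y ↦ (y.2 : y.1 ∈ ((⊥ : TopologicalSpace.Opens E3) : Set E3))⟩
    have hpb : PseudoRiemannianMetric.contMDiff_pullbackBilin (𝓡 4) 𝒟.carrier (𝓡 3)
        (⊥ : TopologicalSpace.Opens E3) ∞ := by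
      intro _ _ _ _ _ y
      exact isEmptyElim y
    have hrange :
        Set.range (fun y : (⊥ : TopologicalSpace.Opens E3) ↦ (isEmptyElim y : 𝒟.carrier)) = ∅ :=
      Set.range_eq_empty _
    refine ⟨(⊥ : TopologicalSpace.Opens E3), inferInstance, inferInstance, inferInstance,
      fun y ↦ isEmptyElim y, hpb, ⟨fun y ↦ isEmptyElim y, fun y ↦ isEmptyElim y⟩,
      fun y ↦ isEmptyElim y, 1, one_pos, fun y ↦ isEmptyElim y,
      ⟨⟨fun y ↦ isEmptyElim y, fun y ↦ isEmptyElim y⟩, fun y ↦ isEmptyElim y⟩,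
      fun y ↦ isEmptyElim y, ?_, ?_, ?_, C, hC, fun m hm ↦ Or.inl (hsub hm)⟩
    · rw [hrange]; exact isClosed_empty
    · rw [hrange]; intro p hp; exact hp.elim
    · rw [hrange]
      intro q hq
      rcases hq with hq | ⟨p, hp, -⟩
      · exact hq.elim
      · exact hp.elim

/-- **What the hypothesis of the line's `NullTerminality` literally says.** For a closed
hypersurface image `range f`, "`γ` is eventually in the vendored `D⁺(range f)`" is "`γ` is eventually
IN `range f`" (the null geodesic lies inside the spacelike hypersurface on a parameter interval),
by §1. -/
theorem eventually_mem_futureCauchyDevelopment_range_iff {D : InitialDataSet (𝓡 3) X}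
    (𝒟 : VacuumCauchyDevelopment D) {N : Type} (f : N → 𝒟.carrier)
    (hclosed : IsClosed (Set.range f)) (γ : ℝ → 𝒟.carrier) (dom : Set ℝ) :
    (∃ t₀ ∈ dom, ∀ t ∈ dom, t₀ ≤ t →
        γ t ∈ 𝒟.metric.futureCauchyDevelopment 𝒟.timeOrientation (Set.range f)) ↔
      ∃ t₀ ∈ dom, ∀ t ∈ dom, t₀ ≤ t → γ t ∈ Set.range f := by
  rw [futureCauchyDevelopment_eq_self_of_isClosed 𝒟.metric 𝒟.timeOrientation hclosed]

end Crush

end Summit.FinalStateConjecture.FinalStateConjecture.Theorems.TameCensorship.Negative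

end
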